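import Summits.QuantumFields.QCD.Theorems.QuarksAsStableActionStableActionBridgeQuadFormProduct
import Summits.QuantumFields.QCD.Theorems.QuarksAsStableActionStableActionBridgeQuadFormLimit
import Summits.QuantumFields.QCD.Theorems.QuarksAsStableActionStableActionBridgeLinkGramExpansion
import Literature.MathematicalPhysics.QuantumFieldTheory.LatticeGaugeProofs

/-!
# The quadratic form of the Wilson pure-gauge transfer kernel is nonnegative
(crux `QuarksAsStableAction.StableActionBridge`, item stmt-QuantumFields-9737, line `Sketch`;
registered stub `gaugeSliceKernel_quadForm_nonneg` of the lead skeleton — the gauge half, at the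
level of quadratic forms, of the Lüscher / Osterwalder–Seiler positivity of the transfer operator)

In temporal gauge the one-step transfer kernel of Wilson's `SU(3)` lattice gauge theory on the
spatial three-torus of side `S` is (Smit, *Introduction to Quantum Fields on a Lattice*, §4.6
(4.121)–(4.129); Lüscher, CMP 54 (1977))

  `K_β(U, U') = f(U) · exp(−β ∑ₗ (3 − Re tr(U_l U'_lᴴ))) · f(U')`,  `f = exp(−(β/2) S₃)`,

(`gaugeSliceKernel`).  We prove that for `β ≥ 0`, every finite measure `μ` on the link
configurations (Haar in the application) and every bounded measurable wave function `Ψ`,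

  `Re ∫∫ conj Ψ(U) K_β(U, U') Ψ(U') dμ(U') dμ(U) ≥ 0`,  `Im (…) = 0`,

i.e. `⟨Ψ, T̂_U Ψ⟩ ≥ 0` for the integral operator `T̂_U` with kernel `K_β`.  Assembly of three
neighbouring results of the line:

* kernel algebra: `K_β(U, U') = f(U) · e^{−3β|E|} · exp(β k(U, U')) · f(U')` with the link Gram
  kernel `k(U, U') = ∑ₗ Re tr(U_l U'_lᴴ)`; the factors `f` (real, `0 < f ≤ 1` since the Wilson
  action of unitary holonomies is `≥ 0`) are folded into the wave function, the positive constant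
  comes out of both integrals (`quadForm_fold`);
* `exp(β k) = lim_N ∑_{n<N} (β k)ⁿ/n!` pointwise with the uniform bound `exp(β · 18|E|)`, so by
  `quadForm_nonneg_of_tendsto` (dominated convergence twice) it suffices to treat the partial sums;
* by the feature expansion `linkGram_pow_feature_expansion`,
  `kⁿ(U, U') = ∑_α G_α(U) G_α(U')` with bounded measurable real features, so each partial sum is a
  finite sum of product kernels `g(U) g(U')` (`g = √(βⁿ/n!) · G_α`), whose quadratic form is
  `∑ |∫ g Ψ|² ≥ 0` (`quadForm_sum_product_kernels_nonneg`).

The analytic core is isolated in the measure-theoretic lemma `quadForm_exp_kernel_nonneg`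
(any finite measure space, any finite family of features bounded by `1`).
-/

noncomputable section

open MeasureTheory Filter Literature.MathematicalPhysics.QuantumFieldTheory
  Literature.MathematicalPhysics.QuantumLattice
open scoped Matrix Topology ComplexConjugate BigOperators

namespace Summit.QuantumFields.QCD.Cruxes.StableActionBridge.Sketch

/-- Transport of "`Re Q ≥ 0 ∧ Im Q = 0`" along a pointwise equality of kernels (the two iterated
quadratic forms are then literally equal). [folklore] -/
private theorem quadForm_nonneg_congr {X : Type} [MeasurableSpace X] (μ : Measure X)
    (K₁ K₂ : X → X → ℝ) (Ψ : X → ℂ) (h : ∀ u u', K₁ u u' = K₂ u u')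
    (h₁ : 0 ≤ (∫ u, ∫ u', conj (Ψ u) * ((K₁ u u' : ℝ) : ℂ) * Ψ u' ∂μ ∂μ).re ∧
      (∫ u, ∫ u', conj (Ψ u) * ((K₁ u u' : ℝ) : ℂ) * Ψ u' ∂μ ∂μ).im = 0) :
    0 ≤ (∫ u, ∫ u', conj (Ψ u) * ((K₂ u u' : ℝ) : ℂ) * Ψ u' ∂μ ∂μ).re ∧
      (∫ u, ∫ u', conj (Ψ u) * ((K₂ u u' : ℝ) : ℂ) * Ψ u' ∂μ ∂μ).im = 0 := by
  obtain rfl : K₁ = K₂ := funext fun u => funext (h u)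
  exact h₁

/-- **Folding a symmetric rank-one weight into the wave function.** If
`K₀(u, u') = f(u) · (c · K(u, u')) · f(u')` with `f`, `c`, `K` real, then
`∫∫ conj Ψ(u) K₀(u, u') Ψ(u') = c · ∫∫ conj (f Ψ)(u) K(u, u') (f Ψ)(u')` (constants out of the
Bochner integrals, `conj (f u) = f u`; no integrability needed). [folklore] -/
private theorem quadForm_fold {X : Type} [MeasurableSpace X] (μ : Measure X) (K₀ K : X → X → ℝ)
    (f : X → ℝ) (c : ℝ) (Ψ : X → ℂ) (hK : ∀ u u', K₀ u u' = f u * (c * K u u') * f u') :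
    ∫ u, ∫ u', conj (Ψ u) * ((K₀ u u' : ℝ) : ℂ) * Ψ u' ∂μ ∂μ =
      (c : ℂ) * ∫ u, ∫ u', conj (((f u : ℝ) : ℂ) * Ψ u) * ((K u u' : ℝ) : ℂ) *
        (((f u' : ℝ) : ℂ) * Ψ u') ∂μ ∂μ := by
  rw [← integral_const_mul]
  refine integral_congr_ae (Eventually.of_forall fun u => ?_)
  dsimp only
  rw [← integral_const_mul]
  refine integral_congr_ae (Eventually.of_forall fun u' => ?_)
  dsimp only
  rw [hK u u']
  simp only [map_mul, Complex.conj_ofReal]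
  push_cast
  ring

/-- Real part versus imaginary part of `c · z` for a real `c ≥ 0`: if `Re z ≥ 0` and `Im z = 0`
then the same holds for `c · z`. [folklore] -/
private theorem re_im_ofReal_mul_nonneg {c : ℝ} (hc : 0 ≤ c) {z : ℂ} (hz : 0 ≤ z.re ∧ z.im = 0) :
    0 ≤ ((c : ℂ) * z).re ∧ ((c : ℂ) * z).im = 0 := by
  rw [Complex.re_ofReal_mul, Complex.im_ofReal_mul, hz.2, mul_zero]
  exact ⟨mul_nonneg hc hz.1, rfl⟩

/-- **Quadratic-form positivity of an exponential feature kernel.** Let `μ` be a finite measure on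
`X`, `φₐ : X → ℝ` (`a` in a finite type) measurable features bounded by `1`, and `k : X → X → ℝ` a
kernel whose powers expand as `k(u, u')ⁿ = ∑_{α : Fin n → A} (∏ₜ φ_{α t}(u)) (∏ₜ φ_{α t}(u'))`
(e.g. `k(u, u') = ∑ₐ φₐ(u) φₐ(u')`).  Then for `β ≥ 0` and every bounded measurable `Ψ : X → ℂ`
the iterated quadratic form of `exp(β k)` has nonnegative real part and zero imaginary part:
the partial sums `∑_{n<N} (β k)ⁿ/n!` are finite sums of product kernels `g(u) g(u')` with
`g = √(βⁿ/n!) ∏ₜ φ_{α t}` bounded and measurable, hence have nonnegative quadratic form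
(`quadForm_sum_product_kernels_nonneg`); they are bounded by `exp(β |A|)` uniformly and converge
pointwise to `exp(β k)` (exponential series), so the claim passes to the limit
(`quadForm_nonneg_of_tendsto`). [folklore] -/
private theorem quadForm_exp_kernel_nonneg (X : Type) [MeasurableSpace X] (μ : Measure X)
    [IsFiniteMeasure μ] (A : Type) [Fintype A] (φ : A → X → ℝ) (k : X → X → ℝ) (β : ℝ)
    (Ψ : X → ℂ) (hφb : ∀ a u, |φ a u| ≤ 1) (hφm : ∀ a, Measurable (φ a))
    (hk : ∀ (n : ℕ) (u u' : X), k u u' ^ n =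
      ∑ α : Fin n → A, (∏ t, φ (α t) u) * ∏ t, φ (α t) u')
    (hβ : 0 ≤ β) (hΨb : ∃ C : ℝ, ∀ u, ‖Ψ u‖ ≤ C) (hΨm : Measurable Ψ) :
    0 ≤ (∫ u, ∫ u', conj (Ψ u) * ((Real.exp (β * k u u') : ℝ) : ℂ) * Ψ u' ∂μ ∂μ).re ∧
      (∫ u, ∫ u', conj (Ψ u) * ((Real.exp (β * k u u') : ℝ) : ℂ) * Ψ u' ∂μ ∂μ).im = 0 := by
  -- feature products: bounded by `1` and measurable
  have hPb : ∀ (n : ℕ) (α : Fin n → A) (u : X), |∏ t, φ (α t) u| ≤ 1 := fun n α u => by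
    rw [Finset.abs_prod]
    exact Finset.prod_le_one (fun t _ => abs_nonneg _) fun t _ => hφb _ _
  have hPm : ∀ (n : ℕ) (α : Fin n → A), Measurable fun u => ∏ t, φ (α t) u := fun n α =>
    Finset.measurable_prod _ fun t _ => hφm (α t)
  -- the kernel itself is the `n = 1` expansion: bounded and jointly measurable
  have hk1 : ∀ u u', k u u' = ∑ α : Fin 1 → A, (∏ t, φ (α t) u) * ∏ t, φ (α t) u' :=
    fun u u' => by rw [← hk 1 u u', pow_one]
  have hkb : ∀ u u', |k u u'| ≤ ∑ _α : Fin 1 → A, (1 : ℝ) := fun u u' => by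
    rw [hk1]
    refine (Finset.abs_sum_le_sum_abs _ _).trans (Finset.sum_le_sum fun α _ => ?_)
    rw [abs_mul]
    exact mul_le_one₀ (hPb 1 α u) (abs_nonneg _) (hPb 1 α u')
  have hkm : Measurable fun p : X × X => k p.1 p.2 := by
    have e : (fun p : X × X => k p.1 p.2) =
        fun p => ∑ α : Fin 1 → A, (∏ t, φ (α t) p.1) * ∏ t, φ (α t) p.2 :=
      funext fun p => hk1 p.1 p.2
    rw [e]
    exact Finset.measurable_sum _ fun α _ =>
      ((hPm 1 α).comp measurable_fst).mul ((hPm 1 α).comp measurable_snd)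
  -- the partial sums of the exponential series: uniform bound, measurability, convergence
  set B : ℝ := ∑ _α : Fin 1 → A, (1 : ℝ) with hB
  have hKb : ∀ (N : ℕ) (u u' : X),
      |∑ n ∈ Finset.range N, (β * k u u') ^ n / (n.factorial : ℝ)| ≤ Real.exp (β * B) := by
    intro N u u'
    refine (Finset.abs_sum_le_sum_abs _ _).trans ?_
    have habs : ∀ n : ℕ, |(β * k u u') ^ n / (n.factorial : ℝ)| =
        |β * k u u'| ^ n / (n.factorial : ℝ) := fun n => by
      rw [abs_div, abs_pow, Nat.abs_cast]
    simp only [habs]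
    refine (Real.sum_le_exp_of_nonneg (abs_nonneg _) N).trans ?_
    rw [Real.exp_le_exp, abs_mul, abs_of_nonneg hβ]
    exact mul_le_mul_of_nonneg_left (hkb u u') hβ
  have hKm : ∀ N : ℕ, Measurable (Function.uncurry
      ((fun (N : ℕ) (u u' : X) => ∑ n ∈ Finset.range N, (β * k u u') ^ n / (n.factorial : ℝ)) N)) :=
    fun N => by
    show Measurable fun p : X × X => ∑ n ∈ Finset.range N, (β * k p.1 p.2) ^ n / (n.factorial : ℝ)
    exact Finset.measurable_sum _ fun n _ => ((hkm.const_mul β).pow_const n).div_const _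
  have hKlm : Measurable (Function.uncurry fun u u' : X => Real.exp (β * k u u')) := by
    show Measurable fun p : X × X => Real.exp (β * k p.1 p.2)
    exact (hkm.const_mul β).exp
  have hlim : ∀ u u' : X, Tendsto
      (fun N : ℕ => ∑ n ∈ Finset.range N, (β * k u u') ^ n / (n.factorial : ℝ)) atTop
      (𝓝 (Real.exp (β * k u u'))) := fun u u' => by
    have h : HasSum (fun n : ℕ => (β * k u u') ^ n / (n.factorial : ℝ)) (Real.exp (β * k u u')) := by
      rw [Real.exp_eq_exp_ℝ]
      exact NormedSpace.expSeries_div_hasSum_exp (β * k u u')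
    exact h.tendsto_sum_nat
  -- positivity of the quadratic form of every partial sum: a finite sum of product kernels
  have hw : ∀ n : ℕ, 0 ≤ β ^ n / (n.factorial : ℝ) := fun n =>
    div_nonneg (pow_nonneg hβ n) (Nat.cast_nonneg _)
  have hpos : ∀ N : ℕ,
      0 ≤ (∫ u, ∫ u', conj (Ψ u) *
          ((∑ n ∈ Finset.range N, (β * k u u') ^ n / (n.factorial : ℝ) : ℝ) : ℂ) * Ψ u' ∂μ ∂μ).re ∧
        (∫ u, ∫ u', conj (Ψ u) *
          ((∑ n ∈ Finset.range N, (β * k u u') ^ n / (n.factorial : ℝ) : ℝ) : ℂ) * Ψ u' ∂μ ∂μ).im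
          = 0 := by
    intro N
    -- the Gram features `g ⟨n, α⟩ = √(βⁿ/n!) ∏ₜ φ (α t)`
    set g : (Σ n : Fin N, (Fin n → A)) → X → ℝ := fun σ u =>
      Real.sqrt (β ^ (σ.1 : ℕ) / ((σ.1 : ℕ).factorial : ℝ)) * ∏ t, φ (σ.2 t) u with hg
    have hgb : ∀ σ : (Σ n : Fin N, (Fin n → A)), ∃ C : ℝ, ∀ u, |g σ u| ≤ C := fun σ =>
      ⟨Real.sqrt (β ^ (σ.1 : ℕ) / ((σ.1 : ℕ).factorial : ℝ)), fun u => by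
        simp only [hg]
        rw [abs_mul, abs_of_nonneg (Real.sqrt_nonneg _)]
        exact mul_le_of_le_one_right (Real.sqrt_nonneg _) (hPb _ _ _)⟩
    have hgm : ∀ σ : (Σ n : Fin N, (Fin n → A)), Measurable (g σ) := fun σ => by
      simp only [hg]
      exact measurable_const.mul (hPm _ _)
    have hnn := quadForm_sum_product_kernels_nonneg X μ (Σ n : Fin N, (Fin n → A)) g Ψ hgb hgm
      hΨb hΨm
    refine quadForm_nonneg_congr μ (fun u u' => ∑ σ : (Σ n : Fin N, (Fin n → A)), g σ u * g σ u')
      (fun u u' => ∑ n ∈ Finset.range N, (β * k u u') ^ n / (n.factorial : ℝ)) Ψ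
      (fun u u' => ?_) hnn
    show ∑ σ : (Σ n : Fin N, (Fin n → A)), g σ u * g σ u' =
      ∑ n ∈ Finset.range N, (β * k u u') ^ n / (n.factorial : ℝ)
    rw [Fintype.sum_sigma, ← Fin.sum_univ_eq_sum_range]
    refine Finset.sum_congr rfl fun n _ => ?_
    calc ∑ α : Fin n → A, g ⟨n, α⟩ u * g ⟨n, α⟩ u'
        = ∑ α : Fin n → A, (β ^ (n : ℕ) / ((n : ℕ).factorial : ℝ)) *
            ((∏ t, φ (α t) u) * ∏ t, φ (α t) u') :=
          Finset.sum_congr rfl fun α _ => by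
            simp only [hg]
            rw [mul_mul_mul_comm, Real.mul_self_sqrt (hw n)]
      _ = (β * k u u') ^ (n : ℕ) / ((n : ℕ).factorial : ℝ) := by
          rw [← Finset.mul_sum, ← hk (n : ℕ) u u', mul_pow]
          ring
  -- pass to the limit
  exact quadForm_nonneg_of_tendsto X μ
    (fun (N : ℕ) (u u' : X) => ∑ n ∈ Finset.range N, (β * k u u') ^ n / (n.factorial : ℝ))
    (fun u u' : X => Real.exp (β * k u u')) Ψ (Real.exp (β * B)) hKb hKm hKlm hlim hΨb hΨm hpos

/-- `Re tr V ≤ 3` for a unitary `3 × 3` matrix (its entries have norm `≤ 1`). [folklore] -/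
private theorem re_trace_le_three {V : Matrix (Fin 3) (Fin 3) ℂ}
    (hV : V ∈ Matrix.unitaryGroup (Fin 3) ℂ) : V.trace.re ≤ 3 := by
  rw [Matrix.trace, Complex.re_sum]
  calc ∑ i, (V.diag i).re ≤ ∑ _i : Fin 3, (1 : ℝ) :=
        Finset.sum_le_sum fun i _ =>
          (Complex.re_le_norm _).trans (entry_norm_bound_of_unitary hV i i)
    _ = 3 := by simp

/-- The Wilson action of `SU(3)` configurations (fundamental representation) is nonnegative:
every plaquette term `3 − Re tr U_p` is. [folklore] -/
private theorem wilsonAction_fundamental_nonneg {S : ℕ} [NeZero S]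
    (U : GaugeConfig 3 S (Matrix.specialUnitaryGroup (Fin 3) ℂ)) :
    0 ≤ wilsonAction (fundamentalRep (Fin 3)) U := by
  unfold wilsonAction
  refine Finset.sum_nonneg fun p _ => sub_nonneg.2 ?_
  refine (re_trace_le_three (fundamentalRep_mem_unitaryGroup _)).trans_eq ?_
  norm_num

/-- **The kernel algebra of the Wilson transfer kernel** (Smit (4.121), (4.129)):
`K_β(U, U') = f(U) · (e^{−3β|E|} · exp(β ∑ₗ Re tr(U_l U'_lᴴ))) · f(U')`, `f = exp(−(β/2) S₃)`,
`|E|` the number of spatial links. [cite: Smit2023, §4.6 (4.121)–(4.129)] -/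
private theorem gaugeSliceKernel_factor {S : ℕ} [NeZero S] (β : ℝ)
    (U U' : GaugeConfig 3 S (Matrix.specialUnitaryGroup (Fin 3) ℂ)) :
    gaugeSliceKernel β U U' =
      Real.exp (-(β / 2) * wilsonAction (fundamentalRep (Fin 3)) U) *
        (Real.exp (-(3 * β * Fintype.card (Edge 3 S))) *
          Real.exp (β * ∑ l : Edge 3 S, ((U l : Matrix (Fin 3) (Fin 3) ℂ) *
            (U' l : Matrix (Fin 3) (Fin 3) ℂ)ᴴ).trace.re)) *
        Real.exp (-(β / 2) * wilsonAction (fundamentalRep (Fin 3)) U') := by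
  have h3 : Real.exp (-(β * ∑ l : Edge 3 S, ((3 : ℝ) -
      ((U l : Matrix (Fin 3) (Fin 3) ℂ) * (U' l : Matrix (Fin 3) (Fin 3) ℂ)ᴴ).trace.re))) =
      Real.exp (-(3 * β * Fintype.card (Edge 3 S))) *
        Real.exp (β * ∑ l : Edge 3 S,
          ((U l : Matrix (Fin 3) (Fin 3) ℂ) * (U' l : Matrix (Fin 3) (Fin 3) ℂ)ᴴ).trace.re) := by
    rw [← Real.exp_add, Finset.sum_sub_distrib, Finset.sum_const, Finset.card_univ, nsmul_eq_mul]
    congr 1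
    ring
  rw [gaugeSliceKernel, h3]

/-- **Nonnegativity of the quadratic form of the Wilson pure-gauge transfer kernel**
(`⟨Ψ, T̂_U Ψ⟩ ≥ 0`, the gauge half of the Lüscher / Osterwalder–Seiler positivity of the transfer
operator, at the level of quadratic forms).  For `β ≥ 0`, a finite measure `μ` on the `SU(3)` link
configurations of the spatial three-torus and a bounded measurable `Ψ`,
`Re ∫∫ conj Ψ(U) K_β(U, U') Ψ(U') dμ(U') dμ(U) ≥ 0` and `Im (…) = 0`.  Proof: write
`K_β(U, U') = f(U) e^{−3β|E|} exp(β k(U, U')) f(U')` (`gaugeSliceKernel_factor`), fold the real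
weights `0 < f ≤ 1` into `Ψ` and pull the positive constant out (`quadForm_fold`); the remaining
kernel `exp(β k)` with the link Gram kernel `k(U, U') = ∑ₗ Re tr(U_l U'_lᴴ)`, whose powers are
finite sums of products of the bounded measurable entry features `Re/Im (U_l)_{ab}`
(`linkGram_pow_feature_expansion`), has a nonnegative quadratic form by
`quadForm_exp_kernel_nonneg`. [cite: Smit2023, §4.6 (4.121)–(4.129)] -/
theorem gaugeSliceKernel_quadForm_nonneg : ∀ (S : ℕ) [NeZero S] (β : ℝ), 0 ≤ β → ∀ (μ : Measure (GaugeConfig 3 S (Matrix.specialUnitaryGroup (Fin 3) ℂ))) [IsFiniteMeasure μ] (Ψ : GaugeConfig 3 S (Matrix.specialUnitaryGroup (Fin 3) ℂ) → ℂ), (∃ C : ℝ, ∀ U, ‖Ψ U‖ ≤ C) → Measurable Ψ → 0 ≤ (∫ U, ∫ U', (starRingEnd ℂ) (Ψ U) * ((gaugeSliceKernel β U U' : ℝ) : ℂ) * Ψ U' ∂μ ∂μ).re ∧ (∫ U, ∫ U', (starRingEnd ℂ) (Ψ U) * ((gaugeSliceKernel β U U' : ℝ) : ℂ) * Ψ U'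 ∂μ ∂μ).im = 0 := by
  intro S _ β hβ μ _ Ψ hΨb hΨm
  obtain ⟨C, hC⟩ := hΨb
  -- Step 1: kernel algebra and folding of the weights `f = exp(−(β/2) S₃)` into `Ψ`
  rw [quadForm_fold μ (gaugeSliceKernel β)
    (fun U U' : GaugeConfig 3 S (Matrix.specialUnitaryGroup (Fin 3) ℂ) =>
      Real.exp (β * ∑ l : Edge 3 S, ((U l : Matrix (Fin 3) (Fin 3) ℂ) *
        (U' l : Matrix (Fin 3) (Fin 3) ℂ)ᴴ).trace.re))
    (fun U : GaugeConfig 3 S (Matrix.specialUnitaryGroup (Fin 3) ℂ) =>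
      Real.exp (-(β / 2) * wilsonAction (fundamentalRep (Fin 3)) U))
    (Real.exp (-(3 * β * Fintype.card (Edge 3 S)))) Ψ (gaugeSliceKernel_factor β)]
  -- Step 2: the folded wave function `f Ψ` is bounded (`0 < f ≤ 1`) and measurable
  have hf1 : ∀ U : GaugeConfig 3 S (Matrix.specialUnitaryGroup (Fin 3) ℂ),
      |Real.exp (-(β / 2) * wilsonAction (fundamentalRep (Fin 3)) U)| ≤ 1 := fun U => by
    rw [abs_of_pos (Real.exp_pos _), Real.exp_le_one_iff]
    nlinarith [wilsonAction_fundamental_nonneg U]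
  have hΨ'b : ∃ C' : ℝ, ∀ U : GaugeConfig 3 S (Matrix.specialUnitaryGroup (Fin 3) ℂ),
      ‖((Real.exp (-(β / 2) * wilsonAction (fundamentalRep (Fin 3)) U) : ℝ) : ℂ) * Ψ U‖ ≤ C' :=
    ⟨C, fun U => by
      rw [norm_mul, Complex.norm_real, Real.norm_eq_abs]
      exact (mul_le_of_le_one_left (norm_nonneg _) (hf1 U)).trans (hC U)⟩
  have hΨ'm : Measurable fun U : GaugeConfig 3 S (Matrix.specialUnitaryGroup (Fin 3) ℂ) =>
      ((Real.exp (-(β / 2) * wilsonAction (fundamentalRep (Fin 3)) U) : ℝ) : ℂ) * Ψ U :=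
    (((measurable_wilsonAction (fundamentalRep (Fin 3)) (continuous_fundamentalRep (Fin 3))).const_mul
      (-(β / 2))).exp.complex_ofReal).mul hΨm
  -- Step 3: the entry features `Re/Im (U_l)_{ab}` are bounded by `1` and measurable, and the powers
  -- of the link Gram kernel expand in them
  have hφb : ∀ (c : Edge 3 S × Fin 3 × Fin 3 × Bool)
      (U : GaugeConfig 3 S (Matrix.specialUnitaryGroup (Fin 3) ℂ)),
      |(fun (c : Edge 3 S × Fin 3 × Fin 3 × Bool)
          (V : GaugeConfig 3 S (Matrix.specialUnitaryGroup (Fin 3) ℂ)) =>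
        if c.2.2.2 then ((V c.1 : Matrix (Fin 3) (Fin 3) ℂ) c.2.1 c.2.2.1).re
        else ((V c.1 : Matrix (Fin 3) (Fin 3) ℂ) c.2.1 c.2.2.1).im) c U| ≤ 1 := by
    rintro ⟨l, a, b, s⟩ U
    have h1 : ‖(U l : Matrix (Fin 3) (Fin 3) ℂ) a b‖ ≤ 1 :=
      entry_norm_bound_of_unitary (Matrix.specialUnitaryGroup_le_unitaryGroup (U l).2) a b
    cases s
    · exact (Complex.abs_im_le_norm _).trans h1
    · exact (Complex.abs_re_le_norm _).trans h1
  have hφm : ∀ c : Edge 3 S × Fin 3 × Fin 3 × Bool, Measurable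
      ((fun (c : Edge 3 S × Fin 3 × Fin 3 × Bool)
          (V : GaugeConfig 3 S (Matrix.specialUnitaryGroup (Fin 3) ℂ)) =>
        if c.2.2.2 then ((V c.1 : Matrix (Fin 3) (Fin 3) ℂ) c.2.1 c.2.2.1).re
        else ((V c.1 : Matrix (Fin 3) (Fin 3) ℂ) c.2.1 c.2.2.1).im) c) := by
    rintro ⟨l, a, b, s⟩
    have hm : Measurable fun V : GaugeConfig 3 S (Matrix.specialUnitaryGroup (Fin 3) ℂ) =>
        (V l : Matrix (Fin 3) (Fin 3) ℂ) a b :=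
      ((continuous_subtype_val.matrix_elem a b).measurable).comp (measurable_pi_apply l)
    cases s
    · exact Complex.measurable_im.comp hm
    · exact Complex.measurable_re.comp hm
  -- Step 4: the measure-theoretic core, and the positive constant `e^{−3β|E|}`
  exact re_im_ofReal_mul_nonneg (Real.exp_pos _).le
    (quadForm_exp_kernel_nonneg (GaugeConfig 3 S (Matrix.specialUnitaryGroup (Fin 3) ℂ)) μ
      (Edge 3 S × Fin 3 × Fin 3 × Bool)
      (fun (c : Edge 3 S × Fin 3 × Fin 3 × Bool)
          (V : GaugeConfig 3 S (Matrix.specialUnitaryGroup (Fin 3) ℂ)) =>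
        if c.2.2.2 then ((V c.1 : Matrix (Fin 3) (Fin 3) ℂ) c.2.1 c.2.2.1).re
        else ((V c.1 : Matrix (Fin 3) (Fin 3) ℂ) c.2.1 c.2.2.1).im)
      (fun U U' : GaugeConfig 3 S (Matrix.specialUnitaryGroup (Fin 3) ℂ) =>
        ∑ l : Edge 3 S, ((U l : Matrix (Fin 3) (Fin 3) ℂ) *
          (U' l : Matrix (Fin 3) (Fin 3) ℂ)ᴴ).trace.re)
      β (fun U => ((Real.exp (-(β / 2) * wilsonAction (fundamentalRep (Fin 3)) U) : ℝ) : ℂ) * Ψ U)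
      hφb hφm (fun n U U' => linkGram_pow_feature_expansion S n U U') hβ hΨ'b hΨ'm)

end Summit.QuantumFields.QCD.Cruxes.StableActionBridge.Sketch

end
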